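import Literature.Analysis.FluidPDE.CheskidovDaiNonlinear
import HarnessLib

/-!
# The weighted sum of the low-mode bounds: absorption above the cut, low-mode factor below it

Analysis/FluidPDE support file (serves the discharge of the named fact
`Literature.Analysis.FluidPDE.cheskidov_dai_occupation_regular`, Cheskidov–Dai, arXiv:1507.06611 =
Proc. Edinburgh Math. Soc. (2025), Thm. 1.1). Summing the block bound of `CheskidovDaiNonlinear.lean` with
the `H¹` weights `4^j` and splitting every weighted sup `t_l = 2^l ‖Δ̇_l v‖_∞` at a cut `J` — below the
cut it is collected into the LOW-MODE FACTOR `f_J = ∑_{l ≤ J} 2^l ‖Δ̇_l v‖_∞` (the paper's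
`f(t) = ∑_{q ≤ Q(t)} λ_q ‖u_q‖_∞`), above the cut it is small, `t_l ≤ κ 4^l` (`l > J`, the definition of
the dissipation wavenumber: `λ_p⁻¹‖u_p‖_∞ < c ν` for `p > Q`) — gives the dyadic form of the paper's
(3.6)–(3.7):

  `∑_{|j| ≤ L} 4^j ‖∫ ⟪Δ̇_j v, Δ̇_j((v·∇)v)⟫‖ ≤ B_f · f_J · F(v) + B_κ · κ · D₄(v)`,

`F(v) = ∑_l 4^l ‖Δ̇_l v‖₂²` the dyadic enstrophy (`dyadicF`) and `D₄(v) = ∑_l 16^l ‖Δ̇_l v‖₂² ≤ C_r² D(v)` the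
dyadic dissipation (`sum_Icc_weighted_nonlinear_le_lowMode`). The constants
`B_f, B_κ` are made of Littlewood–Paley constants only (choosing `κ = c ν`, `c B_κ C_r² ≪ 1`, the second term
is absorbed by the dissipation and the energy inequality becomes `d/dt F ≲ f_J F`, LINEAR in the low-mode
factor). Pure `ℝ≥0∞` bookkeeping: shifted Cauchy–Schwarz (`ParaproductSums`), exchange of the diagonal sum.

## References

* A. Cheskidov, M. Dai, arXiv:1507.06611 = Proc. Edinburgh Math. Soc. (2025), §3.1, (3.6)–(3.7).
  [CheskidovDai2015]
-/

noncomputable section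

open MeasureTheory Filter Topology Function Set
open Literature.Analysis.FunctionSpaces
open scoped ENNReal NNReal RealInnerProductSpace

namespace Literature.Analysis.FluidPDE

section Sums

/-- `2 ≠ 0` in `ℝ≥0∞`. [folklore] -/
private theorem h2ne : (2 : ℝ≥0∞) ≠ 0 := two_ne_zero
/-- `2 ≠ ∞` in `ℝ≥0∞`. [folklore] -/
private theorem h2top : (2 : ℝ≥0∞) ≠ ∞ := ENNReal.ofNat_ne_top

/-- **The cumulative weighted sups split at the cut**: if `t_l ≤ κ 4^l` for `l > J` then
`T_{l'} = ∑_{l ≤ l'-3} t_l ≤ ∑_{l ≤ J} t_l + κ 2^{2 l' - 5}`. [folklore] -/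
private theorem paraT_le_lowSum_add {t : ℤ → ℝ≥0∞} {J : ℤ} {κ : ℝ≥0∞}
    (ht : ∀ l, J < l → t l ≤ κ * (2 : ℝ≥0∞) ^ (2 * l)) (l' : ℤ) :
    paraT t l' ≤ (∑' n : ℕ, t (J - n)) + κ * (2 : ℝ≥0∞) ^ (2 * l' - 5) := by
  unfold paraT
  have hsplit : ∀ n : ℕ, t (l' - 3 - n) ≤
      (if l' - 3 - (n : ℤ) < J + 1 then t (l' - 3 - n) else 0) +
        (if J < l' - 3 - (n : ℤ) then κ * (2 : ℝ≥0∞) ^ (2 * (l' - 3 - (n : ℤ))) else 0) := by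
    intro n
    by_cases h : J < l' - 3 - (n : ℤ)
    · rw [if_neg (by omega), if_pos h, zero_add]; exact ht _ h
    · rw [if_pos (by omega), if_neg h, add_zero]
  refine (ENNReal.tsum_le_tsum hsplit).trans ?_
  rw [ENNReal.tsum_add]
  refine add_le_add ?_ ?_
  · refine (tsum_comp_ite_lt_le t (J + 1) (φ := fun n : ℕ => l' - 3 - (n : ℤ)) (fun a b hab => by simpa using hab)).trans
      (le_of_eq (tsum_congr fun n => by congr 1; ring))
  · have h3 : ∀ n : ℕ, (if J < l' - 3 - (n : ℤ) then κ * (2 : ℝ≥0∞) ^ (2 * (l' - 3 - (n : ℤ))) else 0) ≤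
        κ * (2 : ℝ≥0∞) ^ (2 * ((l' - 3) - (n : ℤ))) := fun n => by split_ifs <;> simp
    refine (ENNReal.tsum_le_tsum h3).trans ?_
    rw [ENNReal.tsum_mul_left]
    gcongr
    refine (tsum_four_zpow_sub_nat_le (l' - 3)).trans_eq ?_
    congr 1; ring

/-- **The low–high / high–low weighted sums**: with `b_l = 2^l a_l`,
`∑_j 4^j a_j a_{j+m} T_{j+m} ≤ 2^{-m} (∑_{l ≤ J} t_l) W(a) + κ 2^{-5} W(b)`. [folklore] -/
private theorem tsum_four_zpow_mul_mul_paraT_le (a t : ℤ → ℝ≥0∞) {J : ℤ} {κ : ℝ≥0∞}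
    (ht : ∀ l, J < l → t l ≤ κ * (2 : ℝ≥0∞) ^ (2 * l)) (m : ℤ) :
    ∑' j, (2 : ℝ≥0∞) ^ (2 * j) * a j * (a (j + m) * paraT t (j + m)) ≤
      (2 : ℝ≥0∞) ^ (-m) * ((∑' n : ℕ, t (J - n)) * dyadicSqSum a) +
        κ * ((2 : ℝ≥0∞) ^ (-5 : ℤ) * dyadicSqSum (fun l => (2 : ℝ≥0∞) ^ l * a l)) := by
  set M := ∑' n : ℕ, t (J - n) with hM
  set b : ℤ → ℝ≥0∞ := fun l => (2 : ℝ≥0∞) ^ l * a l with hb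
  have hstep : ∀ j, (2 : ℝ≥0∞) ^ (2 * j) * a j * (a (j + m) * paraT t (j + m)) ≤
      M * ((2 : ℝ≥0∞) ^ (2 * j) * a j * a (j + m)) +
        κ * ((2 : ℝ≥0∞) ^ (m - 5) * ((2 : ℝ≥0∞) ^ (2 * j) * b j * b (j + m))) := by
    intro j
    calc (2 : ℝ≥0∞) ^ (2 * j) * a j * (a (j + m) * paraT t (j + m))
        ≤ (2 : ℝ≥0∞) ^ (2 * j) * a j * (a (j + m) * (M + κ * (2 : ℝ≥0∞) ^ (2 * (j + m) - 5))) := by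
          gcongr; exact paraT_le_lowSum_add ht _
      _ = M * ((2 : ℝ≥0∞) ^ (2 * j) * a j * a (j + m)) +
          κ * (((2 : ℝ≥0∞) ^ (2 * j) * (2 : ℝ≥0∞) ^ (2 * (j + m) - 5)) * a j * a (j + m)) := by ring
      _ = _ := by
          congr 2
          simp only [hb]
          have : (2 : ℝ≥0∞) ^ (2 * j) * (2 : ℝ≥0∞) ^ (2 * (j + m) - 5) =
              (2 : ℝ≥0∞) ^ (m - 5) * (2 : ℝ≥0∞) ^ (2 * j) * (2 : ℝ≥0∞) ^ j * (2 : ℝ≥0∞) ^ (j + m) := by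
            rw [← ENNReal.zpow_add h2ne h2top, ← ENNReal.zpow_add h2ne h2top, ← ENNReal.zpow_add h2ne h2top,
              ← ENNReal.zpow_add h2ne h2top]
            congr 1; ring
          rw [this]; ring
  refine (ENNReal.tsum_le_tsum hstep).trans ?_
  rw [ENNReal.tsum_add, ENNReal.tsum_mul_left, ENNReal.tsum_mul_left, ENNReal.tsum_mul_left]
  refine add_le_add ?_ ?_
  · calc M * ∑' j, (2 : ℝ≥0∞) ^ (2 * j) * a j * a (j + m) ≤ M * ((2 : ℝ≥0∞) ^ (-m) * dyadicSqSum a) := by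
          gcongr; exact tsum_four_zpow_mul_mul_shift_le_self a m
      _ = _ := by ring
  · calc κ * ((2 : ℝ≥0∞) ^ (m - 5) * ∑' j, (2 : ℝ≥0∞) ^ (2 * j) * b j * b (j + m))
        ≤ κ * ((2 : ℝ≥0∞) ^ (m - 5) * ((2 : ℝ≥0∞) ^ (-m) * dyadicSqSum b)) := by
          gcongr; exact tsum_four_zpow_mul_mul_shift_le_self b m
      _ = κ * ((2 : ℝ≥0∞) ^ (-5 : ℤ) * dyadicSqSum b) := by
          rw [← mul_assoc ((2 : ℝ≥0∞) ^ (m - 5)), ← ENNReal.zpow_add h2ne h2top]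
          congr 3; ring

/-- **The diagonal shape against one power of the wavenumber**: `2^j Q(j) ≤ 80 W(a)` where
`Q(j) = ∑_{l ≥ j-4, |m| ≤ 2} a_l 2^{l+m} a_{l+m}` (`2^j ≤ 16 · 2^l` and shifted Cauchy–Schwarz). [folklore] -/
private theorem two_zpow_mul_paraQ2_le (a : ℤ → ℝ≥0∞) (j : ℤ) :
    (2 : ℝ≥0∞) ^ j * paraQ2 a (fun l => (2 : ℝ≥0∞) ^ l * a l) j ≤ 80 * dyadicSqSum a := by
  unfold paraQ2
  rw [← ENNReal.tsum_mul_left]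
  have hterm : ∀ (n : ℕ) (m : ℤ), (2 : ℝ≥0∞) ^ j * (a (j - 4 + n) * ((2 : ℝ≥0∞) ^ (j - 4 + n + m) * a (j - 4 + n + m))) ≤
      16 * ((2 : ℝ≥0∞) ^ m * ((2 : ℝ≥0∞) ^ (2 * (j - 4 + n)) * a (j - 4 + n) * a (j - 4 + n + m))) := by
    intro n m
    have hj : (2 : ℝ≥0∞) ^ j ≤ 16 * (2 : ℝ≥0∞) ^ (j - 4 + (n : ℤ)) := by
      calc (2 : ℝ≥0∞) ^ j ≤ (2 : ℝ≥0∞) ^ (4 + (j - 4 + (n : ℤ))) := ENNReal.zpow_le_of_le (by norm_num) (by omega)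
        _ = 16 * (2 : ℝ≥0∞) ^ (j - 4 + (n : ℤ)) := by
            rw [ENNReal.zpow_add h2ne h2top, show (4 : ℤ) = (4 : ℕ) by rfl, zpow_natCast]; norm_num
    have hpow : (2 : ℝ≥0∞) ^ (j - 4 + (n : ℤ)) * (2 : ℝ≥0∞) ^ (j - 4 + (n : ℤ) + m) =
        (2 : ℝ≥0∞) ^ m * (2 : ℝ≥0∞) ^ (2 * (j - 4 + (n : ℤ))) := by
      rw [← ENNReal.zpow_add h2ne h2top, ← ENNReal.zpow_add h2ne h2top]; congr 1; ring
    set P := (2 : ℝ≥0∞) ^ (j - 4 + (n : ℤ)) with hP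
    set P' := (2 : ℝ≥0∞) ^ (j - 4 + (n : ℤ) + m) with hP'
    set P2 := (2 : ℝ≥0∞) ^ (2 * (j - 4 + (n : ℤ))) with hP2
    set Pm := (2 : ℝ≥0∞) ^ m with hPm
    calc (2 : ℝ≥0∞) ^ j * (a (j - 4 + n) * (P' * a (j - 4 + n + m)))
        ≤ (16 * P) * (a (j - 4 + n) * (P' * a (j - 4 + n + m))) := by gcongr
      _ = 16 * ((P * P') * (a (j - 4 + n) * a (j - 4 + n + m))) := by ring
      _ = 16 * ((Pm * P2) * (a (j - 4 + n) * a (j - 4 + n + m))) := by rw [hpow]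
      _ = 16 * (Pm * (P2 * a (j - 4 + n) * a (j - 4 + n + m))) := by ring
  calc ∑' n : ℕ, (2 : ℝ≥0∞) ^ j * ∑ m ∈ Finset.Icc (-2 : ℤ) 2, a (j - 4 + n) * ((2 : ℝ≥0∞) ^ (j - 4 + n + m) * a (j - 4 + n + m))
      = ∑' n : ℕ, ∑ m ∈ Finset.Icc (-2 : ℤ) 2, (2 : ℝ≥0∞) ^ j * (a (j - 4 + n) * ((2 : ℝ≥0∞) ^ (j - 4 + n + m) * a (j - 4 + n + m))) := by
        refine tsum_congr fun n => ?_; rw [Finset.mul_sum]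
    _ ≤ ∑' n : ℕ, ∑ m ∈ Finset.Icc (-2 : ℤ) 2, 16 * ((2 : ℝ≥0∞) ^ m * ((2 : ℝ≥0∞) ^ (2 * (j - 4 + n)) * a (j - 4 + n) * a (j - 4 + n + m))) :=
        ENNReal.tsum_le_tsum fun n => Finset.sum_le_sum fun m _ => hterm n m
    _ = ∑ m ∈ Finset.Icc (-2 : ℤ) 2, 16 * ((2 : ℝ≥0∞) ^ m *
          ∑' n : ℕ, (2 : ℝ≥0∞) ^ (2 * (j - 4 + (n : ℤ))) * a (j - 4 + n) * a (j - 4 + n + m)) := by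
        rw [Summable.tsum_finsetSum (fun m _ => ENNReal.summable)]
        refine Finset.sum_congr rfl fun m _ => ?_
        rw [ENNReal.tsum_mul_left, ENNReal.tsum_mul_left]
    _ ≤ ∑ m ∈ Finset.Icc (-2 : ℤ) 2, 16 * ((2 : ℝ≥0∞) ^ m * ((2 : ℝ≥0∞) ^ (-m) * dyadicSqSum a)) := by
        gcongr with m
        -- the sum over `l = j - 4 + n` is part of the sum over all `l`
        calc ∑' n : ℕ, (2 : ℝ≥0∞) ^ (2 * (j - 4 + (n : ℤ))) * a (j - 4 + n) * a (j - 4 + n + m)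
            ≤ ∑' l : ℤ, (2 : ℝ≥0∞) ^ (2 * l) * a l * a (l + m) :=
              ENNReal.tsum_comp_le_tsum_of_injective (f := fun n : ℕ => j - 4 + (n : ℤ)) (fun x y hxy => by simpa using hxy)
                (fun l : ℤ => (2 : ℝ≥0∞) ^ (2 * l) * a l * a (l + m))
          _ ≤ (2 : ℝ≥0∞) ^ (-m) * dyadicSqSum a := tsum_four_zpow_mul_mul_shift_le_self a m
    _ = ∑ _m ∈ Finset.Icc (-2 : ℤ) 2, 16 * dyadicSqSum a := by
        refine Finset.sum_congr rfl fun m _ => ?_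
        rw [← mul_assoc ((2 : ℝ≥0∞) ^ m), ← ENNReal.zpow_add h2ne h2top, add_neg_cancel, zpow_zero, one_mul]
    _ = 80 * dyadicSqSum a := by
        rw [Finset.sum_const, Int.card_Icc, show Int.toNat (2 + 1 - -2) = 5 by decide, nsmul_eq_mul]
        push_cast; ring

/-- **The diagonal shape against three powers of the wavenumber** (exchange of the double sum
`∑_j ∑_{l ≥ j-4} = ∑_l ∑_{j ≤ l+4}` and the geometric series in `j`): with `b_l = 2^l a_l`,
`∑_j 8^j Q(j) ≤ 2^{13} · 20 · W(b)`. [folklore] -/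
private theorem tsum_eight_zpow_mul_paraQ2_le (a : ℤ → ℝ≥0∞) :
    ∑' j, (2 : ℝ≥0∞) ^ (3 * j) * paraQ2 a (fun l => (2 : ℝ≥0∞) ^ l * a l) j ≤
      2 ^ (13 : ℕ) * (20 * dyadicSqSum (fun l => (2 : ℝ≥0∞) ^ l * a l)) := by
  set b : ℤ → ℝ≥0∞ := fun l => (2 : ℝ≥0∞) ^ l * a l with hb
  -- `G m j l = 8^j a_l b_{l+m}`
  set G : ℤ → ℤ → ℤ → ℝ≥0∞ := fun m j l => (2 : ℝ≥0∞) ^ (3 * j) * (a l * b (l + m)) with hG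
  -- Step 1: unfold and bring the finite sum outside
  have h1 : ∑' j, (2 : ℝ≥0∞) ^ (3 * j) * paraQ2 a b j =
      ∑ m ∈ Finset.Icc (-2 : ℤ) 2, ∑' j, ∑' n : ℕ, G m j (j - 4 + n) := by
    unfold paraQ2
    calc ∑' j, (2 : ℝ≥0∞) ^ (3 * j) * ∑' n : ℕ, ∑ m ∈ Finset.Icc (-2 : ℤ) 2, a (j - 4 + n) * b (j - 4 + n + m)
        = ∑' j, ∑' n : ℕ, ∑ m ∈ Finset.Icc (-2 : ℤ) 2, G m j (j - 4 + n) := by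
          refine tsum_congr fun j => ?_
          rw [← ENNReal.tsum_mul_left]
          refine tsum_congr fun n => ?_
          rw [Finset.mul_sum]
      _ = ∑ m ∈ Finset.Icc (-2 : ℤ) 2, ∑' j, ∑' n : ℕ, G m j (j - 4 + n) := by
          rw [← Summable.tsum_finsetSum (fun m _ => ENNReal.summable)]
          refine tsum_congr fun j => ?_
          rw [Summable.tsum_finsetSum (fun m _ => ENNReal.summable)]
  -- Step 2: exchange `∑_j ∑_{n} G(j, j-4+n) = ∑_l ∑_k G(l+4-k, l)`
  have h2 : ∀ m, ∑' j, ∑' n : ℕ, G m j (j - 4 + n) = ∑' l, ∑' k : ℕ, G m (l + 4 - k) l := by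
    intro m
    calc ∑' j, ∑' n : ℕ, G m j (j - 4 + n) = ∑' j, ∑' l, (if j - 4 ≤ l then G m j l else 0) := by
          refine tsum_congr fun j => ?_; rw [tsum_ite_ge_eq (G m j) (j - 4)]
      _ = ∑' l, ∑' j, (if j - 4 ≤ l then G m j l else 0) := ENNReal.tsum_comm
      _ = ∑' l, ∑' j, (if j < l + 5 then G m j l else 0) := by
          refine tsum_congr fun l => tsum_congr fun j => ?_
          by_cases h : j - 4 ≤ l
          · rw [if_pos h, if_pos (by omega)]
          · rw [if_neg h, if_neg (by omega)]
      _ = ∑' l, ∑' k : ℕ, G m (l + 4 - k) l := by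
          refine tsum_congr fun l => ?_
          rw [tsum_ite_lt_eq (fun j => G m j l) (l + 5)]
          exact tsum_congr fun k => by congr 1; ring
  -- Step 3: the geometric sum in `k`: `∑_k 8^{l+4-k} ≤ 2^{3l+13}`
  have h3 : ∀ l : ℤ, ∑' k : ℕ, (2 : ℝ≥0∞) ^ (3 * (l + 4 - (k : ℤ))) ≤ (2 : ℝ≥0∞) ^ (3 * l + 13) := by
    intro l
    calc ∑' k : ℕ, (2 : ℝ≥0∞) ^ (3 * (l + 4 - (k : ℤ))) ≤ ∑' k : ℕ, (2 : ℝ≥0∞) ^ ((3 * l + 12) - (k : ℤ)) :=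
          ENNReal.tsum_le_tsum fun k => ENNReal.zpow_le_of_le (by norm_num) (by omega)
      _ = (2 : ℝ≥0∞) ^ (3 * l + 12 + 1) := tsum_two_zpow_sub_nat _
      _ = (2 : ℝ≥0∞) ^ (3 * l + 13) := by congr 1; ring
  have h4 : ∀ m l, ∑' k : ℕ, G m (l + 4 - k) l ≤ (2 : ℝ≥0∞) ^ (13 : ℕ) * ((2 : ℝ≥0∞) ^ (2 * l) * b l * b (l + m)) := by
    intro m l
    simp only [hG]
    rw [ENNReal.tsum_mul_right]
    calc (∑' k : ℕ, (2 : ℝ≥0∞) ^ (3 * (l + 4 - (k : ℤ)))) * (a l * b (l + m))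
        ≤ (2 : ℝ≥0∞) ^ (3 * l + 13) * (a l * b (l + m)) := mul_le_mul_left (h3 l) _
      _ = (2 : ℝ≥0∞) ^ (13 : ℕ) * ((2 : ℝ≥0∞) ^ (2 * l) * b l * b (l + m)) := by
          simp only [hb]
          rw [show (3 : ℤ) * l + 13 = (13 : ℕ) + 2 * l + l by push_cast; ring, ENNReal.zpow_add h2ne h2top,
            ENNReal.zpow_add h2ne h2top, zpow_natCast]
          ring
  -- Step 4: shifted Cauchy–Schwarz in `l`
  rw [h1]
  calc ∑ m ∈ Finset.Icc (-2 : ℤ) 2, ∑' j, ∑' n : ℕ, G m j (j - 4 + n)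
      = ∑ m ∈ Finset.Icc (-2 : ℤ) 2, ∑' l, ∑' k : ℕ, G m (l + 4 - k) l := Finset.sum_congr rfl fun m _ => h2 m
    _ ≤ ∑ m ∈ Finset.Icc (-2 : ℤ) 2, ∑' l, (2 : ℝ≥0∞) ^ (13 : ℕ) * ((2 : ℝ≥0∞) ^ (2 * l) * b l * b (l + m)) :=
        Finset.sum_le_sum fun m _ => ENNReal.tsum_le_tsum fun l => h4 m l
    _ ≤ ∑ m ∈ Finset.Icc (-2 : ℤ) 2, (2 : ℝ≥0∞) ^ (13 : ℕ) * ((2 : ℝ≥0∞) ^ (-m) * dyadicSqSum b) := by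
        gcongr with m
        rw [ENNReal.tsum_mul_left]
        gcongr
        exact tsum_four_zpow_mul_mul_shift_le_self b m
    _ = (2 : ℝ≥0∞) ^ (13 : ℕ) * ((∑ m ∈ Finset.Icc (-2 : ℤ) 2, (2 : ℝ≥0∞) ^ (-m)) * dyadicSqSum b) := by
        rw [Finset.sum_mul, Finset.mul_sum]
    _ ≤ (2 : ℝ≥0∞) ^ (13 : ℕ) * (20 * dyadicSqSum b) := by gcongr; exact sum_Icc_two_zpow_neg_le

/-- **The weighted diagonal sums**: if `s_j ≤ κ 2^j` for `j > J` then
`∑_j 4^j s_j Q(j) ≤ 80 (∑_{l ≤ J} 2^l s_l) W(a) + κ 2^{13} 20 W(b)`. [folklore] -/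
private theorem tsum_four_zpow_mul_mul_paraQ2_le (a s : ℤ → ℝ≥0∞) {J : ℤ} {κ : ℝ≥0∞}
    (hs : ∀ l, J < l → s l ≤ κ * (2 : ℝ≥0∞) ^ l) :
    ∑' j, (2 : ℝ≥0∞) ^ (2 * j) * (s j * paraQ2 a (fun l => (2 : ℝ≥0∞) ^ l * a l) j) ≤
      80 * ((∑' n : ℕ, (2 : ℝ≥0∞) ^ (J - n) * s (J - n)) * dyadicSqSum a) +
        κ * (2 ^ (13 : ℕ) * (20 * dyadicSqSum (fun l => (2 : ℝ≥0∞) ^ l * a l))) := by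
  set Q : ℤ → ℝ≥0∞ := paraQ2 a (fun l => (2 : ℝ≥0∞) ^ l * a l) with hQ
  set t : ℤ → ℝ≥0∞ := fun l => (2 : ℝ≥0∞) ^ l * s l with ht
  -- split `s_j` at the cut
  have hsplit : ∀ j, (2 : ℝ≥0∞) ^ (2 * j) * (s j * Q j) ≤
      (if j < J + 1 then t j * ((2 : ℝ≥0∞) ^ j * Q j) else 0) + κ * ((2 : ℝ≥0∞) ^ (3 * j) * Q j) := by
    intro j
    have h22 : (2 : ℝ≥0∞) ^ (2 * j) = (2 : ℝ≥0∞) ^ j * (2 : ℝ≥0∞) ^ j := by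
      rw [two_mul, ENNReal.zpow_add h2ne h2top]
    by_cases h : J < j
    · rw [if_neg (by omega), zero_add]
      calc (2 : ℝ≥0∞) ^ (2 * j) * (s j * Q j) ≤ (2 : ℝ≥0∞) ^ (2 * j) * ((κ * (2 : ℝ≥0∞) ^ j) * Q j) := by
            gcongr; exact hs j h
        _ = κ * (((2 : ℝ≥0∞) ^ (2 * j) * (2 : ℝ≥0∞) ^ j) * Q j) := by ring
        _ = κ * ((2 : ℝ≥0∞) ^ (3 * j) * Q j) := by
            rw [← ENNReal.zpow_add h2ne h2top]; congr 3; ring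
    · rw [if_pos (by omega)]
      calc (2 : ℝ≥0∞) ^ (2 * j) * (s j * Q j) = t j * ((2 : ℝ≥0∞) ^ j * Q j) := by
            simp only [ht]; rw [h22]; ring
        _ ≤ _ := le_self_add
  refine (ENNReal.tsum_le_tsum hsplit).trans ?_
  rw [ENNReal.tsum_add, ENNReal.tsum_mul_left]
  refine add_le_add ?_ ?_
  · -- below the cut: `2^j Q(j) ≤ 80 W(a)` and the sum of `t_j`, `j ≤ J`
    calc ∑' j, (if j < J + 1 then t j * ((2 : ℝ≥0∞) ^ j * Q j) else 0)
        ≤ ∑' j, (if j < J + 1 then t j * (80 * dyadicSqSum a) else 0) := by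
          refine ENNReal.tsum_le_tsum fun j => ?_
          split_ifs
          · exact mul_le_mul_right (two_zpow_mul_paraQ2_le a j) _
          · exact le_rfl
      _ = (∑' j, (if j < J + 1 then t j else 0)) * (80 * dyadicSqSum a) := by
          rw [← ENNReal.tsum_mul_right]
          refine tsum_congr fun j => ?_
          split_ifs <;> simp
      _ = (∑' n : ℕ, (2 : ℝ≥0∞) ^ (J - n) * s (J - n)) * (80 * dyadicSqSum a) := by
          rw [tsum_ite_lt_eq t (J + 1)]
          congr 1
          exact tsum_congr fun n => by simp only [ht]; congr 2 <;> ring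
      _ = _ := by ring
  · gcongr
    exact tsum_eight_zpow_mul_paraQ2_le a

end Sums

section Weighted

variable {ι : Type*} [Fintype ι] [Nonempty ι] (K : LPBounds ι)

/-- **The weighted sum of the low-mode bounds** (Cheskidov–Dai 2015, (3.6)–(3.7) in the tree's `H¹`
dyadic form). Let `v` be a divergence-free smooth `L²` field on `ℝ^ι`, `J ∈ ℤ` a cut and `κ ≥ 0` with
`‖Δ̇_l v‖_∞ ≤ κ 2^l` for all `l > J` (the levels above the cut are unsaturated). Then for every `L`,
`∑_{|j| ≤ L} 4^j ‖∫ ⟪Δ̇_j v, Δ̇_j((v·∇)v)⟫‖ ≤ B_f · f_J · F(v) + B_κ · κ · D₄(v)` with the LOW-MODE FACTOR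
`f_J = ∑_{n ≥ 0} 2^{J-n} ‖Δ̇_{J-n} v‖_∞ = ∑_{l ≤ J} 2^l ‖Δ̇_l v‖_∞`, `F = dyadicF`,
`D₄ = ∑_l (4^l ‖Δ̇_l v‖₂)²`, `B_f = 20 (A₁ + A₂) + 80 A₃`, `B_κ = (5/32)(A₁ + A₂) + 2^{13} 20 A₃` in terms of the
constants of `enorm_integral_inner_blockFn_convect_le_lowMode`. [cite: CheskidovDai2015, §3.1 (3.6)–(3.7)] -/
theorem sum_Icc_weighted_nonlinear_le_lowMode
    {Csup : ℝ≥0} (hCsup : ∀ (m : EuclideanSpace ℝ ι) (l : ℤ) (w : EuclideanSpace ℝ ι → EuclideanSpace ℝ ι), IsC1L2Field w →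
      eLpNorm (fun x => fderiv ℝ (blockFn l w) x m) ∞ volume ≤ Csup * ENNReal.ofReal ((2 : ℝ) ^ l * ‖m‖) * eLpNorm (blockFn l w) ∞ volume)
    {CL : ℝ≥0} (hCL : ∀ (l : ℤ) (w : EuclideanSpace ℝ ι → EuclideanSpace ℝ ι), IsSmoothL2Field w →
      (∀ x y, ‖blockFn l w x - blockFn l w y‖ ≤
        (∑ i, (eLpNorm (fun z => fderiv ℝ (blockFn l w) z (stdOrthonormalBasis ℝ (EuclideanSpace ℝ ι) i)) ∞ volume).toReal) *
          ‖x - y‖) ∧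
      ENNReal.ofReal (∑ i, (eLpNorm (fun z => fderiv ℝ (blockFn l w) z (stdOrthonormalBasis ℝ (EuclideanSpace ℝ ι) i))
          ∞ volume).toReal) ≤
        Fintype.card (Fin (Module.finrank ℝ (EuclideanSpace ℝ ι))) * (CL * ENNReal.ofReal ((2 : ℝ) ^ l) *
          eLpNorm (blockFn l w) ∞ volume))
    {v : EuclideanSpace ℝ ι → EuclideanSpace ℝ ι} (hv : IsSmoothL2Field v) (hdiv : VectorCalculus.IsDivFree v)
    {J : ℤ} {κ : ℝ≥0∞} (hs : ∀ l, J < l → blockSup v l ≤ κ * (2 : ℝ≥0∞) ^ l) (L : ℕ) :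
    ∑ j ∈ Finset.Icc (-(L : ℤ)) L, (2 : ℝ≥0∞) ^ (2 * j) * ‖∫ x, ⟪blockFn j v x, blockFn j (convect v v) x⟫‖ₑ ≤
      (20 * (Fintype.card (Fin (Module.finrank ℝ (EuclideanSpace ℝ ι))) *
            (4 * Fintype.card (Fin (Module.finrank ℝ (EuclideanSpace ℝ ι))) * CL *
                ENNReal.ofReal (∫ z : EuclideanSpace ℝ ι, ‖blockKernel (EuclideanSpace ℝ ι) 0 z‖ * ‖z‖) * K.Cb +
              64 * K.C₂ * K.Cb) +
          Fintype.card (Fin (Module.finrank ℝ (EuclideanSpace ℝ ι))) * K.C₂ * Csup) +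
        80 * (Fintype.card (Fin (Module.finrank ℝ (EuclideanSpace ℝ ι))) *
          (∫⁻ z, ‖blockKernel (EuclideanSpace ℝ ι) 0 z‖ₑ) * K.Cb)) *
        ((∑' n : ℕ, (2 : ℝ≥0∞) ^ (J - n) * blockSup v (J - n)) * dyadicF v) +
      ((2 : ℝ≥0∞) ^ (-5 : ℤ) * 5 * (Fintype.card (Fin (Module.finrank ℝ (EuclideanSpace ℝ ι))) *
            (4 * Fintype.card (Fin (Module.finrank ℝ (EuclideanSpace ℝ ι))) * CL *
                ENNReal.ofReal (∫ z : EuclideanSpace ℝ ι, ‖blockKernel (EuclideanSpace ℝ ι) 0 z‖ * ‖z‖) * K.Cb +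
              64 * K.C₂ * K.Cb) +
          Fintype.card (Fin (Module.finrank ℝ (EuclideanSpace ℝ ι))) * K.C₂ * Csup) +
        2 ^ (13 : ℕ) * 20 * (Fintype.card (Fin (Module.finrank ℝ (EuclideanSpace ℝ ι))) *
          (∫⁻ z, ‖blockKernel (EuclideanSpace ℝ ι) 0 z‖ₑ) * K.Cb)) *
        (κ * dyadicSqSum (fun l => (2 : ℝ≥0∞) ^ l * blockL2 v l)) := by
  set d : ℝ≥0∞ := (Fintype.card (Fin (Module.finrank ℝ (EuclideanSpace ℝ ι))) : ℝ≥0∞) with hd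
  set M₁ : ℝ≥0∞ := ENNReal.ofReal (∫ z : EuclideanSpace ℝ ι, ‖blockKernel (EuclideanSpace ℝ ι) 0 z‖ * ‖z‖) with hM₁
  set C₁ : ℝ≥0∞ := ∫⁻ z, ‖blockKernel (EuclideanSpace ℝ ι) 0 z‖ₑ with hC₁
  set A₁₂ : ℝ≥0∞ := d * (4 * d * CL * M₁ * K.Cb + 64 * K.C₂ * K.Cb) + d * K.C₂ * Csup with hA₁₂
  set A₃ : ℝ≥0∞ := d * C₁ * K.Cb with hA₃
  set a : ℤ → ℝ≥0∞ := blockL2 v with ha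
  set s : ℤ → ℝ≥0∞ := blockSup v with hsv
  set t : ℤ → ℝ≥0∞ := fun l => (2 : ℝ≥0∞) ^ l * blockSup v l with ht
  set b : ℤ → ℝ≥0∞ := fun l => (2 : ℝ≥0∞) ^ l * blockL2 v l with hb
  set fJ : ℝ≥0∞ := ∑' n : ℕ, (2 : ℝ≥0∞) ^ (J - n) * blockSup v (J - n) with hfJ
  have hfJ' : fJ = ∑' n : ℕ, t (J - n) := rfl
  have ht4 : ∀ l, J < l → t l ≤ κ * (2 : ℝ≥0∞) ^ (2 * l) := by
    intro l hl
    simp only [ht]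
    calc (2 : ℝ≥0∞) ^ l * blockSup v l ≤ (2 : ℝ≥0∞) ^ l * (κ * (2 : ℝ≥0∞) ^ l) := by gcongr; exact hs l hl
      _ = κ * (2 : ℝ≥0∞) ^ (2 * l) := by rw [two_mul, ENNReal.zpow_add h2ne h2top]; ring
  have hF : dyadicF v = dyadicSqSum a := rfl
  -- the block bounds, summed
  calc ∑ j ∈ Finset.Icc (-(L : ℤ)) L, (2 : ℝ≥0∞) ^ (2 * j) * ‖∫ x, ⟪blockFn j v x, blockFn j (convect v v) x⟫‖ₑ
      ≤ ∑ j ∈ Finset.Icc (-(L : ℤ)) L, (2 : ℝ≥0∞) ^ (2 * j) *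
          (A₁₂ * (a j * ∑ m ∈ Finset.Icc (-2 : ℤ) 2, a (j + m) * paraT t (j + m)) + A₃ * (s j * paraQ2 a b j)) := by
        gcongr with j
        exact enorm_integral_inner_blockFn_convect_le_lowMode K hCsup hCL hv hdiv j
    _ ≤ ∑' j, (2 : ℝ≥0∞) ^ (2 * j) *
          (A₁₂ * (a j * ∑ m ∈ Finset.Icc (-2 : ℤ) 2, a (j + m) * paraT t (j + m)) + A₃ * (s j * paraQ2 a b j)) :=
        ENNReal.sum_le_tsum _
    _ = A₁₂ * ∑ m ∈ Finset.Icc (-2 : ℤ) 2, ∑' j, (2 : ℝ≥0∞) ^ (2 * j) * a j * (a (j + m) * paraT t (j + m)) +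
        A₃ * ∑' j, (2 : ℝ≥0∞) ^ (2 * j) * (s j * paraQ2 a b j) := by
        have hre : ∀ j, (2 : ℝ≥0∞) ^ (2 * j) *
            (A₁₂ * (a j * ∑ m ∈ Finset.Icc (-2 : ℤ) 2, a (j + m) * paraT t (j + m)) + A₃ * (s j * paraQ2 a b j)) =
            A₁₂ * (∑ m ∈ Finset.Icc (-2 : ℤ) 2, (2 : ℝ≥0∞) ^ (2 * j) * a j * (a (j + m) * paraT t (j + m))) +
            A₃ * ((2 : ℝ≥0∞) ^ (2 * j) * (s j * paraQ2 a b j)) := by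
          intro j
          set P := (2 : ℝ≥0∞) ^ (2 * j) with hP
          have h1 : P * (A₁₂ * (a j * ∑ m ∈ Finset.Icc (-2 : ℤ) 2, a (j + m) * paraT t (j + m))) =
              A₁₂ * (∑ m ∈ Finset.Icc (-2 : ℤ) 2, P * a j * (a (j + m) * paraT t (j + m))) := by
            rw [Finset.mul_sum, Finset.mul_sum, Finset.mul_sum, Finset.mul_sum]
            exact Finset.sum_congr rfl fun m _ => by ring
          rw [mul_add, h1]
          ring
        simp_rw [hre]
        rw [ENNReal.tsum_add, ENNReal.tsum_mul_left, ENNReal.tsum_mul_left,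
          Summable.tsum_finsetSum (fun m _ => ENNReal.summable)]
    _ ≤ A₁₂ * ∑ m ∈ Finset.Icc (-2 : ℤ) 2, ((2 : ℝ≥0∞) ^ (-m) * (fJ * dyadicSqSum a) +
          κ * ((2 : ℝ≥0∞) ^ (-5 : ℤ) * dyadicSqSum b)) +
        A₃ * (80 * (fJ * dyadicSqSum a) + κ * (2 ^ (13 : ℕ) * (20 * dyadicSqSum b))) := by
        gcongr with m
        · rw [hfJ']; exact tsum_four_zpow_mul_mul_paraT_le a t ht4 m
        · have h := tsum_four_zpow_mul_mul_paraQ2_le a s hs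
          exact h
    _ ≤ A₁₂ * (20 * (fJ * dyadicSqSum a) + 5 * (κ * ((2 : ℝ≥0∞) ^ (-5 : ℤ) * dyadicSqSum b))) +
        A₃ * (80 * (fJ * dyadicSqSum a) + κ * (2 ^ (13 : ℕ) * (20 * dyadicSqSum b))) := by
        gcongr
        rw [Finset.sum_add_distrib, Finset.sum_const, Int.card_Icc, show Int.toNat (2 + 1 - -2) = 5 by decide,
          ← Finset.sum_mul, nsmul_eq_mul]
        push_cast
        gcongr
        exact sum_Icc_two_zpow_neg_le
    _ = _ := by rw [hF]; ring

end Weighted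

end Literature.Analysis.FluidPDE

end
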